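import Summits.AnomalousDissipation.AnomalousDissipation.Theorems.SawtoothPulseCascadeK1LocalisedCascadePhaseStepOsc

/-!
# K1loc — THE FAT SEGMENT OF THE RESOLVED FIBRE LEDGER, OSCILLATORY GRADE (composition)

Prover lane on the crux `K1LocalisedCascade` (stmt-AnomalousDissipation-19491), route `SawtoothPulseCascade`
(S-B/S-C assembly seat; the LEDGER ASSEMBLY, composition layer, Osc grade).  `…PhaseStepOsc.resolved_step_osc` iterated
along a fat schedule `K_{j+1} = 25K_j` (`j ≥ j₀`, every `K_j ≥ 6`): with `E_j = S_j(K_j) + O_j(K_j)` and the explicit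
per-phase increment `e_j(K_j)` of that file (shell amplitudes `𝔞_j ≥ √A_j(3K_j+1)` and off-cone amplitudes `o_j ≥ √O_j(K_j)`
supplied by the caller),
  `E_{j₀+n} ≤ E_{j₀} + Σ_{i<n} e_{j₀+i}(K_{j₀+i})`  for every `n`.
This is the fat segment between the start box (`E_{j₀}`, ad-k1loc-p3) and the thin tail of the K1loc ledger.
No definitions; no statement about the crux. [cite: Grafakos2014, Prop. 3.1.2 (5), Prop. 3.2.7 (3), §3.1.3] [problem: turb]
-/

-- `Summit.<Summit>.<Problem>`: single-conjunct summit, the duplicate namespace segment is deliberate.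
set_option linter.dupNamespace false

noncomputable section

namespace Summit.AnomalousDissipation.AnomalousDissipation.Theorems.SawtoothPulseCascade.K1Window

open MeasureTheory Set Filter Topology UnitAddTorus Function Complex Metric
open scoped Real ENNReal
open Literature.Analysis Literature.Analysis.FunctionSpaces Literature.Analysis.FunctionSpaces.Torus Literature.Analysis.FluidPDE
open Literature.Analysis.FluidPDE.ShearStage
open Literature.Analysis.FluidPDE.SawtoothCascade Literature.Analysis.FluidPDE.SawtoothCascade.CascadeParams
open Summit.AnomalousDissipation.AnomalousDissipation.Theorems.SawtoothPulseCascade.K1Start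
open Summit.AnomalousDissipation.AnomalousDissipation.Theorems.SawtoothPulseCascade.K1Flat
open Summit.AnomalousDissipation.AnomalousDissipation.Theorems.SawtoothPulseCascade.K1Ledger.From

section Cascade

variable (P : CascadeParams)

set_option maxHeartbeats 800000 in
/-- **THE FAT SEGMENT, OSCILLATORY GRADE** (see the file header): along `K_{j+1} = 25K_j` (`j ≥ j₀`),
`E_{j₀+n} ≤ E_{j₀} + Σ_{i<n} e_{j₀+i}`. [cite: Grafakos2014, Prop. 3.1.2 (5), Prop. 3.2.7 (3), §3.1.3] -/
theorem resolved_segment_osc (hγ : P.γ = 8) (hδ₀ : 0 < P.δ₀) (hd : P.d = 2) (hN₀ : P.N₀ = 1) (hρN : P.ρN = 2)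
    (a b : ℕ → UnitAddTorus (Fin 2) → ℝ) (has : ∀ j, IsSmooth (a j)) (h0 : a 0 = datum)
    (hb : ∀ j, b j = a j ∘ shearMap 0 1 (amp ⟨P.U j, P.U_periodic j, P.contDiff_U (P.δ_pos hδ₀ (by rw [hd]; norm_num) j)⟩ P.γ))
    (hab : ∀ j, a (j + 1) = b j ∘ shearMap 1 0 (amp ⟨P.U j, P.U_periodic j, P.contDiff_U (P.δ_pos hδ₀ (by rw [hd]; norm_num) j)⟩ P.γ))
    (K : ℕ → ℕ) {j₀ : ℕ} (hK : ∀ j, 6 ≤ K j) (hK25 : ∀ j, j₀ ≤ j → K (j + 1) = 25 * K j) {ε : ℝ} (hε : 0 < ε)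
    (hMδT : ∀ j, j₀ ≤ j → max 1 (Real.sqrt (2 * Real.log (1 / (ε / (15 * π * 8 * 4096 * (K j : ℝ)) * (1 / 64) ^ j)))) * P.δ j < π / 2)
    (hMδS : ∀ j, j₀ ≤ j → max 1 (Real.sqrt (2 * Real.log (1 / (ε / (15 * π * 8 * 2 ^ 19 * ((5 * K j : ℕ) : ℝ)) * (1 / 64) ^ j)))) * P.δ j < π / 2)
    (hMδO : ∀ j, j₀ ≤ j → max 1 (Real.sqrt (2 * Real.log (1 / (ε / (7 * π * 8 * 2 ^ 19 * ((6 * K j : ℕ) : ℝ)) * (1 / 64) ^ j)))) * P.δ j < π / 2)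
    (hMδC : ∀ j, j₀ ≤ j → max 1 (Real.sqrt (2 * Real.log (1 / (ε / (7 * π * 8 * 2 ^ 19 * ((3 * K j + 1 : ℕ) : ℝ)) * (1 / 64) ^ j)))) * P.δ j < π / 2)
    (𝔞 o : ℕ → ℝ)
    (h𝔞 : ∀ j, j₀ ≤ j → Real.sqrt (∑' k : Fin 2 → ℤ, (if ((3 * K j + 1 : ℕ) : ℤ) ≤ |k 0| ∧ ((1 : ℕ) : ℤ) * |k 0| ≤ ((2 : ℕ) : ℤ) * |k 1|
            then (1 : ℝ) else 0) * ‖mFourierCoeff (fun x => (a j x : ℂ)) k‖ ^ 2) ≤ 𝔞 j)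
    (ho : ∀ j, j₀ ≤ j → Real.sqrt (∑' k : Fin 2 → ℤ, (if (K j : ℤ) ≤ |k 0| ∧ ((1 : ℕ) : ℤ) * |k 0| ≤ ((4 : ℕ) : ℤ) * |k 1| then (1 : ℝ) else 0) * ‖mFourierCoeff (fun x => (a j x : ℂ)) k‖ ^ 2) ≤ o j) (n : ℕ) :
    (fun j : ℕ => ∑' k : Fin 2 → ℤ, (if |k 0| < (K j : ℤ) then (1 : ℝ) else 0) * ‖mFourierCoeff (fun x => (a j x : ℂ)) k‖ ^ 2 +
      ∑' k : Fin 2 → ℤ, (if (K j : ℤ) ≤ |k 0| ∧ ((1 : ℕ) : ℤ) * |k 0| ≤ ((4 : ℕ) : ℤ) * |k 1| then (1 : ℝ) else 0) * ‖mFourierCoeff (fun x => (a j x : ℂ)) k‖ ^ 2) (j₀ + n) ≤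
      (fun j : ℕ => ∑' k : Fin 2 → ℤ, (if |k 0| < (K j : ℤ) then (1 : ℝ) else 0) * ‖mFourierCoeff (fun x => (a j x : ℂ)) k‖ ^ 2 +
      ∑' k : Fin 2 → ℤ, (if (K j : ℤ) ≤ |k 0| ∧ ((1 : ℕ) : ℤ) * |k 0| ≤ ((4 : ℕ) : ℤ) * |k 1| then (1 : ℝ) else 0) * ‖mFourierCoeff (fun x => (a j x : ℂ)) k‖ ^ 2) j₀ +
      ∑ i ∈ Finset.range n, (fun j : ℕ => Real.sqrt (3 * 2 ^ 2 *
            (4 / 3 * ε ^ 2 + 4 / 3 * (2 * 2 ^ j / (π * (K j : ℝ))) ^ 2 + 8 * 2 ^ j * 15 / (π * (K j : ℝ)) +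
              ((7 * j + 12 : ℕ) : ℝ) * (8 * 2 ^ j * 15 ^ 2 *
                Real.sqrt (4 * (max 1 (Real.sqrt (2 * Real.log (1 / (ε / (15 * π * 8 * 4096 * (K j : ℝ)) * (1 / 64) ^ j)))) * P.δ j) / (π * (K j : ℝ))) +
                8 * 15 ^ 2 * (max 1 (Real.sqrt (2 * Real.log (1 / (ε / (15 * π * 8 * 4096 * (K j : ℝ)) * (1 / 64) ^ j)))) * P.δ j) / π))) ^ 2 +
        2 * Real.sqrt (3 * 2 ^ 2 *
            (4 / 3 * ε ^ 2 + 4 / 3 * (2 * 2 ^ j / (π * (K j : ℝ))) ^ 2 + 8 * 2 ^ j * 15 / (π * (K j : ℝ)) +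
              ((7 * j + 12 : ℕ) : ℝ) * (8 * 2 ^ j * 15 ^ 2 *
                Real.sqrt (4 * (max 1 (Real.sqrt (2 * Real.log (1 / (ε / (15 * π * 8 * 4096 * (K j : ℝ)) * (1 / 64) ^ j)))) * P.δ j) / (π * (K j : ℝ))) +
                8 * 15 ^ 2 * (max 1 (Real.sqrt (2 * Real.log (1 / (ε / (15 * π * 8 * 4096 * (K j : ℝ)) * (1 / 64) ^ j)))) * P.δ j) / π))) * o j +
        (Real.sqrt (3 * (81 / 39) ^ 2 *
            (4 / 3 * ε ^ 2 + 4 / 3 * (2 * 2 ^ j / (π * (5 * (K j : ℝ)))) ^ 2 + 8 * 2 ^ j * 15 / (π * (5 * (K j : ℝ))) +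
              ((7 * j + 19 : ℕ) : ℝ) * (8 * 2 ^ j * 15 ^ 2 *
                Real.sqrt (4 * (max 1 (Real.sqrt (2 * Real.log (1 / (ε / (15 * π * 8 * 2 ^ 19 * ((5 * K j : ℕ) : ℝ)) * (1 / 64) ^ j)))) * P.δ j) / (π * (5 * (K j : ℝ)))) +
                8 * 15 ^ 2 * (max 1 (Real.sqrt (2 * Real.log (1 / (ε / (15 * π * 8 * 2 ^ 19 * ((5 * K j : ℕ) : ℝ)) * (1 / 64) ^ j)))) * P.δ j) / π))) +
          Real.sqrt (3 * (77 / 37) ^ 2 *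
            (4 / 3 * ε ^ 2 + 4 / 3 * (2 * 2 ^ j / (π * (2 * ((3 * K j + 1 : ℕ) : ℝ)))) ^ 2 + 8 * 2 ^ j * 7 / (π * (2 * ((3 * K j + 1 : ℕ) : ℝ))) +
              ((7 * j + 19 : ℕ) : ℝ) * (8 * 2 ^ j * 7 ^ 2 *
                Real.sqrt (4 * (max 1 (Real.sqrt (2 * Real.log (1 / (ε / (7 * π * 8 * 2 ^ 19 * ((3 * K j + 1 : ℕ) : ℝ)) * (1 / 64) ^ j)))) * P.δ j) / (π * (2 * ((3 * K j + 1 : ℕ) : ℝ)))) +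
                8 * 7 ^ 2 * (max 1 (Real.sqrt (2 * Real.log (1 / (ε / (7 * π * 8 * 2 ^ 19 * ((3 * K j + 1 : ℕ) : ℝ)) * (1 / 64) ^ j)))) * P.δ j) / π))) + 𝔞 j + Real.sqrt (((1 + P.γ) ^ (2 * j) / (((3 * K j + 1) * 2 ^ (7 * j + 19) : ℕ) : ℝ)) ^ 2)) ^ 2 +
        (Real.sqrt (3 * (81 / 39) ^ 2 *
            (4 / 3 * ε ^ 2 + 4 / 3 * (2 * 2 ^ j / (π * (12 * (K j : ℝ)))) ^ 2 + 8 * 2 ^ j * 7 / (π * (12 * (K j : ℝ))) +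
              ((7 * j + 19 : ℕ) : ℝ) * (8 * 2 ^ j * 7 ^ 2 *
                Real.sqrt (4 * (max 1 (Real.sqrt (2 * Real.log (1 / (ε / (7 * π * 8 * 2 ^ 19 * ((6 * K j : ℕ) : ℝ)) * (1 / 64) ^ j)))) * P.δ j) / (π * (12 * (K j : ℝ)))) +
                8 * 7 ^ 2 * (max 1 (Real.sqrt (2 * Real.log (1 / (ε / (7 * π * 8 * 2 ^ 19 * ((6 * K j : ℕ) : ℝ)) * (1 / 64) ^ j)))) * P.δ j) / π))) +
          Real.sqrt (3 * (77 / 37) ^ 2 *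
            (4 / 3 * ε ^ 2 + 4 / 3 * (2 * 2 ^ j / (π * (2 * ((3 * K j + 1 : ℕ) : ℝ)))) ^ 2 + 8 * 2 ^ j * 7 / (π * (2 * ((3 * K j + 1 : ℕ) : ℝ))) +
              ((7 * j + 19 : ℕ) : ℝ) * (8 * 2 ^ j * 7 ^ 2 *
                Real.sqrt (4 * (max 1 (Real.sqrt (2 * Real.log (1 / (ε / (7 * π * 8 * 2 ^ 19 * ((3 * K j + 1 : ℕ) : ℝ)) * (1 / 64) ^ j)))) * P.δ j) / (π * (2 * ((3 * K j + 1 : ℕ) : ℝ)))) +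
                8 * 7 ^ 2 * (max 1 (Real.sqrt (2 * Real.log (1 / (ε / (7 * π * 8 * 2 ^ 19 * ((3 * K j + 1 : ℕ) : ℝ)) * (1 / 64) ^ j)))) * P.δ j) / π))) + 𝔞 j + Real.sqrt (((1 + P.γ) ^ (2 * j) / (((3 * K j + 1) * 2 ^ (7 * j + 19) : ℕ) : ℝ)) ^ 2)) ^ 2 +
        ((1 + P.γ) ^ (2 * (j + 1)) / (((5 * K j) * 2 ^ (7 * j + 19) : ℕ) : ℝ)) ^ 2 +
        ((1 + P.γ) ^ (2 * j) / ((K j * 2 ^ (7 * j + 12) : ℕ) : ℝ)) ^ 2 +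
        ((1 + P.γ) ^ (2 * (j + 1)) / (((6 * K j) * 2 ^ (7 * j + 19) : ℕ) : ℝ)) ^ 2) (j₀ + i) := by
  induction n with
  | zero =>
    rw [Finset.sum_range_zero]
    exact (add_zero _).symm.le
  | succ n ih =>
    have hj : j₀ ≤ j₀ + n := Nat.le_add_right _ _
    have hs := resolved_step_osc P hγ hδ₀ hd hN₀ hρN a b has h0 hb hab (hK (j₀ + n)) hε (j₀ + n) (hMδT _ hj) (hMδS _ hj)
      (hMδO _ hj) (hMδC _ hj) (h𝔞 _ hj) (ho _ hj)
    rw [Finset.sum_range_succ]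
    beta_reduce at ih ⊢
    rw [show j₀ + (n + 1) = j₀ + n + 1 from rfl, hK25 _ hj]
    have key : ∀ {L M E R x : ℝ}, L ≤ M + x → M ≤ E + R → L ≤ E + (R + x) := by intros; linarith
    exact key hs ih

end Cascade

end Summit.AnomalousDissipation.AnomalousDissipation.Theorems.SawtoothPulseCascade.K1Window
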